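import Summits.BirchSwinnertonDyer.BirchSwinnertonDyer.Theorems.KatoDescentPotSupersingularTowerTorsionFiniteOrdinary
import Summits.BirchSwinnertonDyer.BirchSwinnertonDyer.Theorems.KatoDescentPotSupersingularReducibleKatoMemberOfFineInputsImaiOrd
import HarnessLib

/-!
# 27962 (`Kato2004.exists_memberHullZetaCoreInputs`), THE O6 NODE BEHIND CRUX M AND U₀-red FROM {Fine, H2X⁺, Lim, FW} ALONE —
# NO IMAI, ON EVERY ROW (route-free helper for crux M = stmt-BirchSwinnertonDyer-19196 `ReducibleKatoMember`, K9 / K8-t′;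
# seat `bsd-potss-rkm` g32)

WHY.  Seat g30 (p677595 / p678466) derived the held core package 27962 from {`exists_memberHullZetaFineInputs`, H2X⁺, Lim 3.5,
Ferrero–Washington} ⊕ the Imai schema (`W_K(ℚ_{p,∞})[p^∞] < ∞`); g31 (p680827) halved the schema to the potentially ORDINARY rows
(`hImaiOrd`), the potentially supersingular rows being the tree theorem p680430.  This generation PROVED the potentially ordinary half
for odd `p` (`TowerTorsionFiniteOrdinary.finite_fixedPoints_kerSubgroup_inf_decomp_of_potentiallyOrdinary`: local ordinary lemma via
Weil-pairing annihilators + the ramified cyclotomic lemma + kmc's line-free reduction + Serre-style transport), hence Imai's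
finiteness at EVERY potentially good ODD prime (`…_of_padicValRat_j_nonneg`).  Since 27962 and crux M only ever meet ODD `p`, the
Imai input DISAPPEARS:

* `exists_memberHullZetaCoreInputs_of_fineInputs` — **`exists_memberHullZetaFineInputs → H2X⁺ → Lim 3.5 → FW →
  exists_memberHullZetaCoreInputs`** (27962 = `PublishedInputMemberHullZetaCore` on K9 and K8-t′ = U₀-red's
  `PublishedInputKatoCorePackageU0Red[T]`), NO local-torsion input, NO abstract `𝐇²` hypothesis, on EVERY row of the package
  (the proof of `FineInputsImaiOrd.exists_memberHullZetaCoreInputs_of_fineInputs_of_imaiOrd` with `hfin` now a theorem);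
* `katoMemberShaBoundOfReducible_of_newform_of_fineInputs` — **the O6 node `O6.KatoMemberShaBoundOfReducible` (= crux M's decl on both
  routes, ALL reducible additive potentially good rows, `p` odd, potentially ordinary rows INCLUDED) from {modularity, Fine, H2X⁺, Lim, FW}**;
* `missingUpperBoundAt_of_fineInputs` — U₀-red's reducible upper half (`MissingUpperBoundAt` at `r_an = 0`) from the same atoms ⊕
  {Cassels, GZK, entire `L`} (U₀-red's other held inputs, displayed as in the prequels).

HONEST FRAMING.  Theorems only (no definition, no named fact, no `sorry`); route-free (imports no `Theses.*`); closes nothing by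
itself (crux M stays cite-level over the four named Literature constants + modularity); BSD is proved for no curve.  TRUST BASE of
crux M after this file, in the kernel, on ALL its rows: {`exists_isNewformOf`, `exists_memberHullZetaFineInputs`,
`exists_iwasawaH2Data_fineSelmerDual_embedding_count`, `Lim2017.thm35_…`, `ferreroWashington1979_classicalMuVanishes`} — Kato's
Euler-system theorems and two classical Iwasawa-theoretic facts; no Imai, no 27962, no GZK, no Poitou–Tate hypothesis.

References: [Kato2004Asterisque] Thm. 12.5 (pp. 221–222), Cor. 14.3, Thm. 14.5 (pp. 235–236), (14.9.1)–(14.9.3) (pp. 239–240),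
§14.14 (p. 243), Prop. 14.16 (2) (pp. 244–245); [Imai1975] Theorem (p. 12) (now a tree theorem at odd `p`); [Serre1967GroupesPDivisibles]
§5 Prop. 8; [Wuthrich2014] Lemma 14 (p. 396); tree: `…TowerTorsionFiniteOrdinary.lean` (this seat, g32), `…TowerTorsionFinite.lean`
(g31), `…MemberHullCoreInputsOfFine.lean` (g30), `…ReducibleKatoMemberOfFineInputsImaiOrd.lean` (g31).
-/

-- the summit and its single problem are both named `BirchSwinnertonDyer` (registry layout D-0017)
set_option linter.dupNamespace false
set_option autoImplicit false

noncomputable section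

open scoped Classical NumberField TensorProduct
open Function Field NumberField IsDedekindDomain WeierstrassCurve CongruenceSubgroup
open Literature.NumberTheory.EllipticCurves Literature.NumberTheory.EllipticCurves.GreenbergSelmer
open Literature.NumberTheory.GaloisRepresentations Literature.NumberTheory.GaloisCohomology
open Literature.NumberTheory.EllipticCurves.ModularForms
open Literature.NumberTheory.EllipticCurves.Kato2004 Literature.NumberTheory.EllipticCurves.Kato2004.EulerSystemValues
open Literature.NumberTheory.EllipticCurves.IwasawaAlgebra Literature.NumberTheory.EllipticCurves.IwasawaDual
open Literature.NumberTheory.EllipticCurves.Rank1Residual Literature.NumberTheory.EllipticCurves.Rank1Residual.Typed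
open Summit.BirchSwinnertonDyer.Rank1Residual Summit.BirchSwinnertonDyer.Rank1Residual.Additive
open Summit.BirchSwinnertonDyer.BirchSwinnertonDyer.Theorems
open Summit.BirchSwinnertonDyer.BirchSwinnertonDyer.Theorems.IntegralH1LayerZeroTop

universe u

namespace Summit.BirchSwinnertonDyer.BirchSwinnertonDyer.Theorems.FineInputsNoImai

/-- **`exists_memberHullZetaFineInputs → H2X⁺ → Lim 3.5 → FW → exists_memberHullZetaCoreInputs`, NO Imai** — the held core
package 27962 (`PublishedInputMemberHullZetaCore` on K9 / K8-t′, U₀-red's `PublishedInputKatoCorePackageU0Red[T]`) from the four named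
facts ALONE on every row: the finiteness `W'(ℚ_{p,∞})[p^∞] < ∞` that H2X⁺ wants at Kato's member `W'` is the tree theorem
`TowerTorsionFiniteOrdinary.finite_fixedPoints_kerSubgroup_inf_decomp_of_padicValRat_j_nonneg` (`p` odd, `0 ≤ ord_p j(W')`).
[cite: Kato2004Asterisque, Thm. 12.5 (1)–(3) (pp. 221–222), Cor. 14.3 and Thm. 14.5 (pp. 235–236), (14.9.1) (p. 239), (14.9.3) (p. 240), §14.14 (p. 243), Prop. 14.16 (2) (pp. 244–245)]
[cite: Imai1975, Theorem (p. 12)] [cite: Serre1967GroupesPDivisibles, §5 Prop. 8] [cite: Wuthrich2014, Lemma 14 (p. 396)] -/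
theorem exists_memberHullZetaCoreInputs_of_fineInputs (hF : exists_memberHullZetaFineInputs)
    (hH : exists_iwasawaH2Data_fineSelmerDual_embedding_count)
    (hLim : Lim2017.thm35_fineSelmerDual_moduleFinite_of_classicalMuVanishes_of_le_divisionField)
    (hFW : Literature.NumberTheory.IwasawaTheory.ferreroWashington1979_classicalMuVanishes) :
    exists_memberHullZetaCoreInputs := by
  intro W _ _ p _ hp hgood hmult hj hirr hL hsha
  have hpp : p.Prime := Fact.out
  have hPT : poitouTate_selmerStructure_duality ℚ :=
    poitouTate_selmerStructure_duality_of_conj (InputsPoitouTateSelmer.poitouTate_selmerStructure_duality_conj_holds ℚ)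
  obtain ⟨W', hW'e, hW'm, hiso, hrest⟩ := hF W p hp hgood hmult hj hirr hL hsha
  haveI := hW'e
  haveI := hW'm
  -- transports along the isogeny `W ∼ W'`
  have hirr' : ¬ W'.HasIrreducibleModPGaloisRep p := Rank1Residual.not_hasIrreducibleModPGaloisRep_of_isIsogenous hiso hirr
  obtain ⟨φ⟩ := hiso
  have hj' : 0 ≤ padicValRat p W'.j := padicValRat_j_nonneg_of_isogeny φ hpp hj
  have hshaW' : W'.ShaFinite := (show IsIsogenous W W' from ⟨φ⟩).shaFinite_iff_shaFinite.mp hsha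
  haveI : Finite W'.sha := hshaW'
  refine ⟨W', hW'e, hW'm, ⟨φ⟩, ?_⟩
  intro _ _ _ N _ f hf ι
  obtain ⟨κ', Λ', c, d, a, A, z, x, hκ', hA, hc, hd, hZB, hall⟩ := hrest f hf ι
  refine ⟨κ', Λ', c, d, a, A, z, x, hκ', hA, hc, hd, hZB, ?_⟩
  intro κ γ hκ hγ I y hy
  obtain ⟨Z⟩ := hall κ γ hκ hγ I y hy
  -- the place of `ℚ` at `p` and the finiteness at the member: a THEOREM at every potentially good odd prime
  let v : HeightOneSpectrum (𝓞 ℚ) := Rat.HeightOneSpectrum.primesEquiv.symm ⟨p, hpp⟩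
  have hv : ((Rat.HeightOneSpectrum.primesEquiv v : Nat.Primes) : ℕ) = p := by
    simp only [v, Equiv.apply_symm_apply]
  have hfin : Finite (FixedPoints.addSubgroup ↥(κ.kerSubgroup ⊓ decomp v) (W'.geomPrimaryTorsion p)) :=
    TowerTorsionFiniteOrdinary.finite_fixedPoints_kerSubgroup_inf_decomp_of_padicValRat_j_nonneg W' p hp hj' κ hκ v hv
  -- `W'(ℚ)` finite from clause (b′) of the package; `Ш(W')[p^∞]` finite from `Ш(W)` finite
  haveI : Finite W'.toAffine.Point := by
    obtain ⟨q, -, e, -, hZL⟩ := Z.zetaLineIndex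
    exact ZetaLineRankZero.finite_point_of_zetaLineOrthIndexAt W' p hPT hp
      (layerZeroToTop_mem_integralH1 W' p κ (I.proj_mem 0 y)) hZL
  haveI : Finite (AddCommGroup.primaryComponent W'.sha p) := inferInstance
  -- H2X⁺ at the member, and the assembly of the core package
  obtain ⟨J, eX, heX, hcokX, hc⟩ := hH W' p κ γ hγ v hp hκ hv hfin I
  exact CoreInputsOfFine.nonempty_coreInputs_of_fineInputs W' p hLim hFW hp hκ hγ hirr' Z J eX heX hcokX
    (hc inferInstance inferInstance)

/-- **THE O6 NODE BEHIND CRUX M (`O6.KatoMemberShaBoundOfReducible` = `ReducibleKatoMember` on K9 and K8-t′) from modularity, Fine,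
H2X⁺, Lim and FW — NO Imai, ALL rows** (reducible additive potentially good rows, `p` odd, potentially ordinary rows included).
[cite: Kato2004Asterisque, Thm. 12.6 (p. 222), Prop. 14.16 (2) (pp. 244–245)] [cite: Imai1975, Theorem (p. 12)]
[cite: Serre1967GroupesPDivisibles, §5 Prop. 8] -/
theorem katoMemberShaBoundOfReducible_of_newform_of_fineInputs (hmod : exists_isNewformOf)
    (hF : exists_memberHullZetaFineInputs) (hH : exists_iwasawaH2Data_fineSelmerDual_embedding_count)
    (hLim : Lim2017.thm35_fineSelmerDual_moduleFinite_of_classicalMuVanishes_of_le_divisionField)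
    (hFW : Literature.NumberTheory.IwasawaTheory.ferreroWashington1979_classicalMuVanishes) :
    Rank1Residual.O6.KatoMemberShaBoundOfReducible :=
  ZetaLineRankZero.katoMemberShaBoundOfReducible_of_newform_of_coreInputs hmod
    (exists_memberHullZetaCoreInputs_of_fineInputs hF hH hLim hFW)

/-- **U₀-red's reducible upper half (`MissingUpperBoundAt` at `r_an = 0`) from the same atoms, NO Imai** (U₀-red's other held inputs —
`nonempty_iwasawaH1Data` (a tree theorem, kept displayed as in the prequel), Cassels, GZK, entire `L` — as before).
[cite: Kato2004Asterisque, §14.14 (p. 243), proof of Prop. 14.16 (pp. 244–245)] [cite: Imai1975, Theorem (p. 12)] -/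
theorem missingUpperBoundAt_of_fineInputs (hne : Kato2004.nonempty_iwasawaH1Data) (hmod : exists_isNewformOf)
    (hF : exists_memberHullZetaFineInputs) (hH : exists_iwasawaH2Data_fineSelmerDual_embedding_count)
    (hLim : Lim2017.thm35_fineSelmerDual_moduleFinite_of_classicalMuVanishes_of_le_divisionField)
    (hFW : Literature.NumberTheory.IwasawaTheory.ferreroWashington1979_classicalMuVanishes)
    (hCassels : bsdRHS_eq_of_isIsogenous) (hGZK : rank_eq_analyticRank_of_analyticRank_le_one)
    (hmodL : hasEntireLFunction_rat)
    (W : WeierstrassCurve ℚ) [W.IsElliptic] [W.IsGloballyMinimal] (p : ℕ) [Fact p.Prime]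
    (hp : p ≠ 2) (hng : ¬ W.HasGoodReductionAtPrime p) (hnm : ¬ W.HasMultiplicativeReductionAtPrime p)
    (hj : 0 ≤ padicValRat p W.j) (hred : ¬ W.HasIrreducibleModPGaloisRep p)
    (hr : W.analyticRank = 0) : MissingUpperBoundAt W p :=
  ReducibleUpperOfCoreInputs.missingUpperBoundAt_of_coreInputs' hne hmod
    (exists_memberHullZetaCoreInputs_of_fineInputs hF hH hLim hFW) hCassels hGZK hmodL
    W p hp hng hnm hj hred hr

end Summit.BirchSwinnertonDyer.BirchSwinnertonDyer.Theorems.FineInputsNoImai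

end
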